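import Summits.Ventures.HodgeRepro2.T5SU11JacobiPhaseTailMonotone
import Summits.Ventures.HodgeRepro2.T5SU11PhaseTailCartan
import Summits.Ventures.HodgeRepro2.T5SU11OrbitRadiusLaw

/-!
# The stochastic order in the weight: increasing functions of the phase, the orbit radius, the Cartan coordinate

`T5SU11JacobiPhaseTailMonotone` proves that the phase is stochastically decreasing in the weight. Three
consequences, for `k₁ ≤ k₂` on the ray and every `λ`:

* **every increasing function of the phase has antitone mean in the weight**
  (`mean_monotone_phase_antitone`: `⟨h(log|a|)⟩_{k₂,λ} ≤ ⟨h(log|a|)⟩_{k₁,λ}` for `h` monotone with `h(s) e^{−(k−2)s} Φ_λ`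
  integrable — Chebyshev with `g = h`; `mean_phase_antitone` of `T5SU11JacobiPhaseOrbitCovariance` is the case `h = id`);
* **the squared orbit radius is stochastically decreasing in the weight**
  (`orbit_sq_tail_prob_antitone`: `P_{k₂,λ}(|g·0|² > y) ≤ P_{k₁,λ}(|g·0|² > y)`, `0 ≤ y < 1`);
* **the Cartan coordinate is stochastically decreasing in the weight**
  (`cartan_tail_prob_antitone`: `P_{k₂,λ}(t(g) > τ) ≤ P_{k₁,λ}(t(g) > τ)`, `τ ≥ 0`),

the last two through the set identities of `T5SU11OrbitRadiusLaw` / `T5SU11PhaseTailCartan` (`|g·0|² = 1 − e^{−2 log|a|}`,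
`|a| = cosh t`). Heavier weights concentrate the explicit model `π_k⁺` nearer the identity in every one of its three
coordinates, in distribution. Nothing is claimed about (N).

Blind lane: Mathlib + the HodgeRepro2 prefix only; no sorry; axioms ⊆ {propext, Classical.choice,
Quot.sound}.
-/

namespace Summit.Ventures.HodgeRepro2.T5SU11JacobiStochasticOrder

open MeasureTheory MeasureTheory.Measure Metric Set Filter Topology
open T5SU11Unimodular T5SU11Fibration T5SU11Cartan T5SU11OneParameter T5SU11CartanProjection T5HaarCircle
  T5BergmanCoefficient T5SU11FibrationHaar T5SU11SphericalFunction T5SU11SphericalSymmetry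
  T5SU11SphericalBounds T5SU11SphericalContinuous T5SU11JacobiIwasawa T5SU11JacobiTransform
  T5SU11JacobiWeight T5SU11KFiniteMajorantPow T5SU11JacobiLaplacePhase T5SU11JacobiPhaseTailGroup
  T5SU11PhaseTailCartan T5SU11OrbitRadiusLaw T5SU11JacobiPhaseTailMonotone
open scoped Real

section measure

variable [MeasurableSpace Circle] [BorelSpace Circle]

/-! ### Increasing functions of the phase -/

/-- **Every increasing function of the phase has antitone mean in the weight** (phase form): for `k₁ ≤ k₂` on
the ray, `h` monotone with `h(s) e^{−(k−2)s} Φ_λ(s)` integrable on `(0, ∞)` for `k = k₁, k₂`,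
`∫ h e^{−(k₂−2)s} Φ_λ / ∫ e^{−(k₂−2)s} Φ_λ ≤ ∫ h e^{−(k₁−2)s} Φ_λ / ∫ e^{−(k₁−2)s} Φ_λ`. -/
theorem mean_monotone_phase_antitone {k₁ k₂ lam : ℝ} (hk : 1 < k₁) (h1 : lam < k₁) (h2 : 2 < k₁ + lam)
    (hle : k₁ ≤ k₂) {h : ℝ → ℝ} (hm : Monotone h)
    (hi₁ : IntegrableOn (fun s => h s * (Real.exp (-((k₁ - 2) * s)) * sphPhase lam s)) (Ioi 0))
    (hi₂ : IntegrableOn (fun s => h s * (Real.exp (-((k₂ - 2) * s)) * sphPhase lam s)) (Ioi 0)) :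
    (∫ s in Ioi (0 : ℝ), h s * (Real.exp (-((k₂ - 2) * s)) * sphPhase lam s))
        / (∫ s in Ioi (0 : ℝ), Real.exp (-((k₂ - 2) * s)) * sphPhase lam s)
      ≤ (∫ s in Ioi (0 : ℝ), h s * (Real.exp (-((k₁ - 2) * s)) * sphPhase lam s))
        / (∫ s in Ioi (0 : ℝ), Real.exp (-((k₁ - 2) * s)) * sphPhase lam s) := by
  set w : ℝ → ℝ := fun s => Real.exp (-((k₁ - 2) * s)) * sphPhase lam s with hw
  set f : ℝ → ℝ := fun s => Real.exp (-((k₂ - k₁) * s)) with hf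
  have hw0 : ∀ s, 0 ≤ w s := fun s => mul_nonneg (Real.exp_pos _).le (sphPhase_pos lam s).le
  have hfa : Antitone f := fun s t hst => by
    simp only [hf]
    exact Real.exp_le_exp.mpr (by nlinarith)
  have hfw_eq : ∀ s, f s * w s = Real.exp (-((k₂ - 2) * s)) * sphPhase lam s := fun s => by
    simp only [hf, hw]
    rw [← mul_assoc, ← Real.exp_add]
    congr 2
    ring
  have hwi : IntegrableOn w (Ioi 0) := integrableOn_exp_mul_sphPhase hk h1 h2
  have hfw : IntegrableOn (fun s => f s * w s) (Ioi 0) := by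
    simp_rw [hfw_eq]
    exact integrableOn_exp_mul_sphPhase (by linarith) (by linarith) (by linarith)
  have hgw : IntegrableOn (fun s => h s * w s) (Ioi 0) := hi₁
  have hfgw : IntegrableOn (fun s => f s * h s * w s) (Ioi 0) := by
    refine hi₂.congr_fun (fun s _ => ?_) measurableSet_Ioi
    simp only
    rw [← hfw_eq s]
    ring
  have key := integral_mul_mul_le_of_antitone_monotone hw0 hfa hm hwi hfw hgw hfgw
  have e1 : ∫ s in Ioi (0 : ℝ), f s * h s * w s
      = ∫ s in Ioi (0 : ℝ), h s * (Real.exp (-((k₂ - 2) * s)) * sphPhase lam s) :=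
    setIntegral_congr_fun measurableSet_Ioi fun s _ => by rw [← hfw_eq s]; ring
  have e2 : ∫ s in Ioi (0 : ℝ), f s * w s = ∫ s in Ioi (0 : ℝ), Real.exp (-((k₂ - 2) * s)) * sphPhase lam s :=
    setIntegral_congr_fun measurableSet_Ioi fun s _ => hfw_eq s
  rw [e1, e2] at key
  have hN1 : 0 < ∫ s in Ioi (0 : ℝ), Real.exp (-((k₁ - 2) * s)) * sphPhase lam s := by
    have := jacobi_pos hk h1 h2
    rw [jacobi_eq_laplace_phase hk h1 h2] at this
    exact pos_of_mul_pos_right this (by positivity)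
  have hN2 : 0 < ∫ s in Ioi (0 : ℝ), Real.exp (-((k₂ - 2) * s)) * sphPhase lam s := by
    have := jacobi_pos (k := k₂) (lam := lam) (by linarith) (by linarith) (by linarith)
    rw [jacobi_eq_laplace_phase (by linarith) (by linarith) (by linarith)] at this
    exact pos_of_mul_pos_right this (by positivity)
  rw [div_le_div_iff₀ hN2 hN1]
  exact key.trans_eq (by ring)

/-! ### The orbit radius and the Cartan coordinate -/

/-- **THE SQUARED ORBIT RADIUS IS STOCHASTICALLY DECREASING IN THE WEIGHT**: for `k₁ ≤ k₂` on the ray, every `λ`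
and `0 ≤ y < 1`, `P_{k₂,λ}(|g·0|² > y) ≤ P_{k₁,λ}(|g·0|² > y)`. -/
theorem orbit_sq_tail_prob_antitone {k₁ k₂ lam : ℝ} (hk : 1 < k₁) (h1 : lam < k₁) (h2 : 2 < k₁ + lam)
    (hle : k₁ ≤ k₂) {y : ℝ} (hy0 : 0 ≤ y) (hy1 : y < 1) :
    (∫ g in {g : SU11 | y < ‖orbit g‖ ^ 2}, (1 - ‖orbit g‖ ^ 2) ^ (k₂ / 2) * sph lam g ∂(nu haarCircle))
        / (∫ g, (1 - ‖orbit g‖ ^ 2) ^ (k₂ / 2) * sph lam g ∂(nu haarCircle))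
      ≤ (∫ g in {g : SU11 | y < ‖orbit g‖ ^ 2}, (1 - ‖orbit g‖ ^ 2) ^ (k₁ / 2) * sph lam g ∂(nu haarCircle))
        / (∫ g, (1 - ‖orbit g‖ ^ 2) ^ (k₁ / 2) * sph lam g ∂(nu haarCircle)) := by
  rw [setOf_norm_orbit_sq_gt_eq hy1]
  refine phase_tail_prob_antitone hk h1 h2 hle ?_
  have : Real.log (1 - y) ≤ 0 := Real.log_nonpos (by linarith) (by linarith)
  linarith

/-- **THE CARTAN COORDINATE IS STOCHASTICALLY DECREASING IN THE WEIGHT**: for `k₁ ≤ k₂` on the ray, every `λ`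
and `τ ≥ 0`, `P_{k₂,λ}(t(g) > τ) ≤ P_{k₁,λ}(t(g) > τ)`. -/
theorem cartan_tail_prob_antitone {k₁ k₂ lam : ℝ} (hk : 1 < k₁) (h1 : lam < k₁) (h2 : 2 < k₁ + lam)
    (hle : k₁ ≤ k₂) {τ : ℝ} (hτ : 0 ≤ τ) :
    (∫ g in {g : SU11 | τ < cartanT g}, (1 - ‖orbit g‖ ^ 2) ^ (k₂ / 2) * sph lam g ∂(nu haarCircle))
        / (∫ g, (1 - ‖orbit g‖ ^ 2) ^ (k₂ / 2) * sph lam g ∂(nu haarCircle))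
      ≤ (∫ g in {g : SU11 | τ < cartanT g}, (1 - ‖orbit g‖ ^ 2) ^ (k₁ / 2) * sph lam g ∂(nu haarCircle))
        / (∫ g, (1 - ‖orbit g‖ ^ 2) ^ (k₁ / 2) * sph lam g ∂(nu haarCircle)) := by
  rw [setOf_cartanT_gt_eq hτ]
  exact phase_tail_prob_antitone hk h1 h2 hle
    (Real.log_nonneg (Real.one_le_cosh τ))

end measure

end Summit.Ventures.HodgeRepro2.T5SU11JacobiStochasticOrder
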